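import Summits.CriticalPhenomena.CardyFormulaZ2.Theorems.CardyIKTransportIKMixedBoxCrossingTransportStubLinkArcsIffAux2

/-!
# Stub `stub_linkArcsIff` — H1 of the link decomposition: ARCS EVENT = NECKLACE LINK FUNCTION AT THE CROSSING VECTOR
# (line `defect-closure-exploration`, reshape v5b, crux `IKMixedBoxCrossing`, stmt-CriticalPhenomena-5911)

Support file (`--supports stmt-CriticalPhenomena-5911`), proving the registered stub `stub_linkArcsIff : LinkArcsIff` of
`…TransportLinkDefs` §4: for an interior configuration `y` of the slab of `w` face columns whose last cell column is
presented by the necklace `N`, and a new column `(c, f)`, the arcs event of the wider slab at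
`(splitEquiv w L).symm (y, (c, f))` holds iff `N.Phi y n (N.crossVec c f)`.

"⇐" is `LinkArcsIffStub.arcs_of_phi` (`…TransportStubLinkArcsIffAux2`).  "⇒" (this file, `phi_of_arcs`) is an
induction along the black path of the wider slab, read as a chain of black edges (`rtg_of_blackConn`), carrying an
INVARIANT stated for an arbitrary set `C` of runs containing the runs meeting the first arc and closed under `N.Linked`
(in the end: the runs CHAINED to the first arc): an old cell is joined INSIDE `y` to the first arc or to a run of `C`; a
new-column cell sits, at some offset `o`, next to a run of `C`, or on a gap crossed FROM BELOW up to `o` from a run of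
`C` (the gap cells up to `o` black in `c` and the bottom condition of `Necklace.cross`), or on a gap crossed FROM ABOVE
down to `o` from a run of `C` (top condition).  The four kinds of black edges preserve it (`good_step`): old–old edges
are edges of `y` (`adj_castSucc_iff`); entering the new column from a run cell horizontally / by a main diagonal / by an
anti-diagonal starts such a partial crossing (`goodN_of_entry`); a vertical step in the new column extends it, and when
it reaches the far end of the gap the gap is crossed, so the run beyond is in `C` (`goodN_step`); leaving the new column
onto a run cell either meets the run of `C` itself or completes a crossing (`mem_of_exit`) — all by the step lemmas of
`…TransportStubLinkArcsIffAux`.  At the endpoint on the second arc the invariant is `N.Phi`.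
-/

noncomputable section

namespace Summit.CriticalPhenomena.CardyFormulaZ2.Cruxes.IKMixedBoxCrossing.DefectClosureExploration

open scoped Classical
open CylBunchStub (splitEquiv)
open LinkHonCountStub (row_inj)

namespace LinkArcsIffStub

variable {L : ℕ} {N : Necklace L} {w : ℕ} {y : CylCfg w L} {c f : ZMod L → Bool} {n : ℕ} {C : Fin N.k → Prop}

/-! ## §4 Old cells: joined inside `y` to the first arc or to a run of `C` -/

/-- OLD → OLD: a black edge of `y` preserves the invariant of old cells. -/
theorem goodI_step {i i' : Fin (w + 1)} {r r' : ZMod L}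
    (hg : (∃ r₁ : ZMod L, n ≤ r₁.val ∧ r₁.val < 3 * n ∧ BlackConn y ((0 : Fin (w + 1)), r₁) (i, r)) ∨
      ∃ j, C j ∧ ∃ v ∈ N.runCells j, BlackConn y v (i, r))
    (hb : y.1 (i', r') = true) (ha : (cylGraph w L y.2).Adj (i, r) (i', r')) :
    (∃ r₁ : ZMod L, n ≤ r₁.val ∧ r₁.val < 3 * n ∧ BlackConn y ((0 : Fin (w + 1)), r₁) (i', r')) ∨
      ∃ j, C j ∧ ∃ v ∈ N.runCells j, BlackConn y v (i', r') := by
  rcases hg with ⟨r₁, h1, h2, hB⟩ | ⟨j, hj, v, hv, hB⟩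
  · exact Or.inl ⟨r₁, h1, h2, blackConn_step hB hb ha⟩
  · exact Or.inr ⟨j, hj, v, hv, blackConn_step hB hb ha⟩

/-- A run whose cell satisfies the invariant is in `C`. -/
theorem mem_of_goodI (hC₁ : ∀ j, N.RunMeets y n (3 * n) j → C j)
    (hC₂ : ∀ {j j' : Fin N.k}, C j → N.Linked y (N.crossVec c f) j j' → C j') {r : ZMod L}
    (hg : (∃ r₁ : ZMod L, n ≤ r₁.val ∧ r₁.val < 3 * n ∧
        BlackConn y ((0 : Fin (w + 1)), r₁) (Fin.last w, r)) ∨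
      ∃ j, C j ∧ ∃ v ∈ N.runCells j, BlackConn y v (Fin.last w, r))
    {j : Fin N.k} {o : ℕ} (ho : N.InRun j o) (hr : N.row o = r) : C j := by
  have hmem : ((Fin.last w, r) : Fin (w + 1) × ZMod L) ∈ N.runCells j := hr ▸ mk_mem_runCells N ho
  rcases hg with ⟨r₁, h1, h2, hB⟩ | ⟨j', hj', v, hv, hB⟩
  · exact hC₁ j ⟨r₁, h1, h2, _, hmem, hB⟩
  · exact hC₂ hj' (Or.inr (Or.inr ⟨v, hv, _, hmem, hB⟩))

/-! ## §5 The three kinds of black edges at the new column -/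

/-- OLD → NEW: entering the new column from a cell of a run of `C` (horizontally, by the main diagonal, or by the
anti-diagonal) lands on a cell satisfying the invariant of new cells. -/
theorem goodN_of_entry {r s : ZMod L} {j : Fin N.k} {o : ℕ} (hC : C j) (ho : N.InRun j o) (hr : N.row o = r)
    (hs : c s = true) (he : s = r ∨ (s = r + 1 ∧ f r = false) ∨ (r = s + 1 ∧ f s = true)) :
    ∃ o, o < L ∧ N.row o = s ∧ ((∃ i, N.InRun i o ∧ C i) ∨
      (∃ i, N.InGap i o ∧ C i ∧ (∀ t, N.gapStart i ≤ t → t ≤ o → c (N.row t) = true) ∧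
        (c (N.row (N.gapStart i - 1)) = true ∨ f (N.row (N.gapStart i - 1)) = false)) ∨
      (∃ i, N.InGap i o ∧ (∃ j : Fin N.k, j.val = (i.val + 1) % N.k ∧ C j) ∧
        (∀ t, o ≤ t → t < N.gapStart i + N.gapLen i → c (N.row t) = true) ∧
        (c (N.row (N.gapStart i + N.gapLen i)) = true ∨ f (N.row (N.gapStart i + N.gapLen i - 1)) = true))) := by
  have hoL := inRun_lt N ho
  rcases he with rfl | ⟨rfl, hf⟩ | ⟨hrs, hf⟩
  · exact ⟨o, hoL, hr, Or.inl ⟨j, ho, hC⟩⟩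
  · obtain ⟨ho1, h | ⟨hgs, hgap⟩⟩ := inRun_step_up N ho
    · exact ⟨o + 1, ho1, by rw [row_succ, hr], Or.inl ⟨j, h, hC⟩⟩
    · refine ⟨o + 1, ho1, by rw [row_succ, hr], Or.inr (Or.inl ⟨j, hgap, hC, fun t h1 h2 => ?_, Or.inr ?_⟩)⟩
      · rw [show t = o + 1 by omega, row_succ, hr]
        exact hs
      · rw [← hgs, Nat.add_sub_cancel, hr]
        exact hf
  · have hs' : ∀ {o' : ℕ}, N.row o' + 1 = N.row o → N.row o' = s := fun hro =>
      add_right_cancel (hro.trans (hr.trans hrs))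
    obtain ⟨o', ho', hro, h | ⟨i, hij, hgap, hoe⟩⟩ := inRun_step_down N ho
    · exact ⟨o', ho', hs' hro, Or.inl ⟨j, h, hC⟩⟩
    · refine ⟨o', ho', hs' hro, Or.inr (Or.inr ⟨i, hgap, ⟨j, hij, hC⟩, fun t h1 h2 => ?_, Or.inr ?_⟩)⟩
      · rw [show t = o' by omega, hs' hro]
        exact hs
      · rw [← hoe, Nat.add_sub_cancel, hs' hro]
        exact hf

/-- NEW → NEW: a vertical black step in the new column preserves the invariant of new cells (a partial crossing is
extended; when it reaches the far end of the gap, the gap is crossed and the run beyond it is in `C`). -/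
theorem goodN_step (hC₂ : ∀ {j j' : Fin N.k}, C j → N.Linked y (N.crossVec c f) j j' → C j') {r s : ZMod L}
    (hg : ∃ o, o < L ∧ N.row o = r ∧ ((∃ i, N.InRun i o ∧ C i) ∨
      (∃ i, N.InGap i o ∧ C i ∧ (∀ t, N.gapStart i ≤ t → t ≤ o → c (N.row t) = true) ∧
        (c (N.row (N.gapStart i - 1)) = true ∨ f (N.row (N.gapStart i - 1)) = false)) ∨
      (∃ i, N.InGap i o ∧ (∃ j : Fin N.k, j.val = (i.val + 1) % N.k ∧ C j) ∧
        (∀ t, o ≤ t → t < N.gapStart i + N.gapLen i → c (N.row t) = true) ∧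
        (c (N.row (N.gapStart i + N.gapLen i)) = true ∨ f (N.row (N.gapStart i + N.gapLen i - 1)) = true))))
    (hr : c r = true) (hs : c s = true) (he : s = r + 1 ∨ r = s + 1) :
    ∃ o, o < L ∧ N.row o = s ∧ ((∃ i, N.InRun i o ∧ C i) ∨
      (∃ i, N.InGap i o ∧ C i ∧ (∀ t, N.gapStart i ≤ t → t ≤ o → c (N.row t) = true) ∧
        (c (N.row (N.gapStart i - 1)) = true ∨ f (N.row (N.gapStart i - 1)) = false)) ∨
      (∃ i, N.InGap i o ∧ (∃ j : Fin N.k, j.val = (i.val + 1) % N.k ∧ C j) ∧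
        (∀ t, o ≤ t → t < N.gapStart i + N.gapLen i → c (N.row t) = true) ∧
        (c (N.row (N.gapStart i + N.gapLen i)) = true ∨ f (N.row (N.gapStart i + N.gapLen i - 1)) = true))) := by
  obtain ⟨o, hoL, hro, hD⟩ := hg
  rcases he with rfl | hrs
  · -- one row UP
    rcases hD with ⟨i, ho, hC⟩ | ⟨i, ho, hC, hcov, hbot⟩ | ⟨i, ho, hCn, hcov, htop⟩
    · obtain ⟨ho1, h | ⟨hgs, hgap⟩⟩ := inRun_step_up N ho
      · exact ⟨o + 1, ho1, by rw [row_succ, hro], Or.inl ⟨i, h, hC⟩⟩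
      · refine ⟨o + 1, ho1, by rw [row_succ, hro], Or.inr (Or.inl ⟨i, hgap, hC, fun t h1 h2 => ?_, Or.inl ?_⟩)⟩
        · rw [show t = o + 1 by omega, row_succ, hro]
          exact hs
        · rw [← hgs, Nat.add_sub_cancel, hro]
          exact hr
    · rcases inGap_step_up N ho with ⟨ho1, hgap⟩ | ⟨hoe, j, hj, hrow⟩
      · refine ⟨o + 1, ho1, by rw [row_succ, hro], Or.inr (Or.inl ⟨i, hgap, hC, fun t h1 h2 => ?_, hbot⟩)⟩
        rcases Nat.lt_or_ge t (o + 1) with ht | ht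
        · exact hcov t h1 (by omega)
        · rw [show t = o + 1 by omega, row_succ, hro]
          exact hs
      · have hx : N.cross c f i = true := (cross_eq_true_iff N c f i).2
          ⟨fun t ht => hcov t ht.1 (by unfold Necklace.InGap at ht; omega), hbot,
            Or.inl (by rw [← hoe, row_succ, hro]; exact hs)⟩
        exact ⟨N.runStart j, inRun_lt N (inRun_runStart N j), by rw [← hrow, row_succ, hro],
          Or.inl ⟨j, inRun_runStart N j, hC₂ hC (Or.inl ⟨hx, hj⟩)⟩⟩
    · rcases inGap_step_up N ho with ⟨ho1, hgap⟩ | ⟨-, j, hj, hrow⟩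
      · exact ⟨o + 1, ho1, by rw [row_succ, hro],
          Or.inr (Or.inr ⟨i, hgap, hCn, fun t h1 h2 => hcov t (by omega) h2, htop⟩)⟩
      · obtain ⟨j', hj', hC'⟩ := hCn
        have hjj : j' = j := Fin.ext (by rw [hj', hj])
        subst hjj
        exact ⟨N.runStart j', inRun_lt N (inRun_runStart N j'), by rw [← hrow, row_succ, hro],
          Or.inl ⟨j', inRun_runStart N j', hC'⟩⟩
  · -- one row DOWN
    rcases hD with ⟨i, ho, hC⟩ | ⟨i, ho, hC, hcov, hbot⟩ | ⟨i, ho, hCn, hcov, htop⟩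
    · obtain ⟨o', ho', hro', h | ⟨j, hij, hgap, hoe⟩⟩ := inRun_step_down N ho
      · exact ⟨o', ho', add_right_cancel (hro'.trans (hro.trans hrs)), Or.inl ⟨i, h, hC⟩⟩
      · have hs' : N.row o' = s := add_right_cancel (hro'.trans (hro.trans hrs))
        refine ⟨o', ho', hs', Or.inr (Or.inr ⟨j, hgap, ⟨i, hij, hC⟩, fun t h1 h2 => ?_, Or.inl ?_⟩)⟩
        · rw [show t = o' by omega, hs']
          exact hs
        · rw [← hoe, row_succ, hro', hro]
          exact hr
    · obtain ⟨o', hoo, hgap | ⟨-, hrun⟩⟩ := inGap_step_down N ho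
      · have hs' : N.row o' = s := add_right_cancel (by rw [← row_succ, hoo, hro, hrs])
        exact ⟨o', by omega, hs', Or.inr (Or.inl ⟨i, hgap, hC, fun t h1 h2 => hcov t h1 (by omega), hbot⟩)⟩
      · have hs' : N.row o' = s := add_right_cancel (by rw [← row_succ, hoo, hro, hrs])
        exact ⟨o', by omega, hs', Or.inl ⟨i, hrun, hC⟩⟩
    · obtain ⟨o', hoo, hgap | ⟨hog, hrun⟩⟩ := inGap_step_down N ho
      · have hs' : N.row o' = s := add_right_cancel (by rw [← row_succ, hoo, hro, hrs])
        refine ⟨o', by omega, hs', Or.inr (Or.inr ⟨i, hgap, hCn, fun t h1 h2 => ?_, htop⟩)⟩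
        rcases Nat.lt_or_ge t o with ht | ht
        · rw [show t = o' by omega, hs']
          exact hs
        · exact hcov t ht h2
      · have hs' : N.row o' = s := add_right_cancel (by rw [← row_succ, hoo, hro, hrs])
        obtain ⟨j, hj, hCj⟩ := hCn
        have hx : N.cross c f i = true := (cross_eq_true_iff N c f i).2
          ⟨fun t ht => hcov t (by unfold Necklace.InGap at ht; omega) (by unfold Necklace.InGap at ht; omega),
            Or.inl (by rw [← hog, ← hoo, Nat.add_sub_cancel, hs']; exact hs), htop⟩
        exact ⟨o', by omega, hs', Or.inl ⟨i, hrun, hC₂ hCj (Or.inr (Or.inl ⟨hx, hj⟩))⟩⟩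

/-- NEW → OLD: leaving the new column from a cell satisfying the invariant onto a run cell (horizontally, by the
anti-diagonal upwards, or by the main diagonal downwards), that run is in `C`. -/
theorem mem_of_exit (hC₂ : ∀ {j j' : Fin N.k}, C j → N.Linked y (N.crossVec c f) j j' → C j') {r : ZMod L}
    (hg : ∃ o, o < L ∧ N.row o = r ∧ ((∃ i, N.InRun i o ∧ C i) ∨
      (∃ i, N.InGap i o ∧ C i ∧ (∀ t, N.gapStart i ≤ t → t ≤ o → c (N.row t) = true) ∧
        (c (N.row (N.gapStart i - 1)) = true ∨ f (N.row (N.gapStart i - 1)) = false)) ∨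
      (∃ i, N.InGap i o ∧ (∃ j : Fin N.k, j.val = (i.val + 1) % N.k ∧ C j) ∧
        (∀ t, o ≤ t → t < N.gapStart i + N.gapLen i → c (N.row t) = true) ∧
        (c (N.row (N.gapStart i + N.gapLen i)) = true ∨ f (N.row (N.gapStart i + N.gapLen i - 1)) = true))))
    {i₁ : Fin N.k} {o₁ : ℕ} (ho₁ : N.InRun i₁ o₁)
    (he : N.row o₁ = r ∨ (N.row o₁ = r + 1 ∧ f r = true) ∨ (r = N.row o₁ + 1 ∧ f (N.row o₁) = false)) :
    C i₁ := by
  have ho₁L := inRun_lt N ho₁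
  obtain ⟨o, hoL, hro, hD⟩ := hg
  rcases he with he | ⟨he, hf⟩ | ⟨he, hf⟩
  · -- horizontal exit: `o₁ = o`
    obtain rfl : o₁ = o := row_inj N ho₁L hoL (he.trans hro.symm)
    rcases hD with ⟨i, ho, hC⟩ | ⟨i, ho, -⟩ | ⟨i, ho, -⟩
    · rwa [eq_of_inRun_inRun N ho₁ ho]
    · exact (not_inRun_inGap N ho₁ ho).elim
    · exact (not_inRun_inGap N ho₁ ho).elim
  · -- exit one row up, by the anti-diagonal
    have hup : N.row o₁ = N.row (o + 1) := by rw [he, row_succ, hro]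
    rcases hD with ⟨i, ho, hC⟩ | ⟨i, ho, hC, hcov, hbot⟩ | ⟨i, ho, hCn, -, -⟩
    · obtain ⟨ho1, h | ⟨-, hgap⟩⟩ := inRun_step_up N ho
      · obtain rfl : o₁ = o + 1 := row_inj N ho₁L ho1 hup
        rwa [eq_of_inRun_inRun N ho₁ h]
      · obtain rfl : o₁ = o + 1 := row_inj N ho₁L ho1 hup
        exact (not_inRun_inGap N ho₁ hgap).elim
    · rcases inGap_step_up N ho with ⟨ho1, hgap⟩ | ⟨hoe, j, hj, hrow⟩
      · obtain rfl : o₁ = o + 1 := row_inj N ho₁L ho1 hup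
        exact (not_inRun_inGap N ho₁ hgap).elim
      · have hx : N.cross c f i = true := (cross_eq_true_iff N c f i).2
          ⟨fun t ht => hcov t ht.1 (by unfold Necklace.InGap at ht; omega), hbot,
            Or.inr (by rw [← hoe, Nat.add_sub_cancel, hro]; exact hf)⟩
        obtain rfl : o₁ = N.runStart j :=
          row_inj N ho₁L (inRun_lt N (inRun_runStart N j)) (by rw [← hrow, hup])
        rw [eq_of_inRun_inRun N ho₁ (inRun_runStart N j)]
        exact hC₂ hC (Or.inl ⟨hx, hj⟩)
    · rcases inGap_step_up N ho with ⟨ho1, hgap⟩ | ⟨-, j, hj, hrow⟩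
      · obtain rfl : o₁ = o + 1 := row_inj N ho₁L ho1 hup
        exact (not_inRun_inGap N ho₁ hgap).elim
      · obtain ⟨j', hj', hC'⟩ := hCn
        have hjj : j' = j := Fin.ext (by rw [hj', hj])
        subst hjj
        obtain rfl : o₁ = N.runStart j' :=
          row_inj N ho₁L (inRun_lt N (inRun_runStart N j')) (by rw [← hrow, hup])
        rwa [eq_of_inRun_inRun N ho₁ (inRun_runStart N j')]
  · -- exit one row down, by the main diagonal
    have hdown : ∀ {o' : ℕ}, N.row o' + 1 = N.row o → N.row o₁ = N.row o' := fun hro' =>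
      add_right_cancel (by rw [← he, hro', hro])
    rcases hD with ⟨i, ho, hC⟩ | ⟨i, ho, hC, -, -⟩ | ⟨i, ho, hCn, hcov, htop⟩
    · obtain ⟨o', ho', hro', h | ⟨j, -, hgap, -⟩⟩ := inRun_step_down N ho
      · obtain rfl : o₁ = o' := row_inj N ho₁L ho' (hdown hro')
        rwa [eq_of_inRun_inRun N ho₁ h]
      · obtain rfl : o₁ = o' := row_inj N ho₁L ho' (hdown hro')
        exact (not_inRun_inGap N ho₁ hgap).elim
    · obtain ⟨o', hoo, hgap | ⟨-, hrun⟩⟩ := inGap_step_down N ho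
      · obtain rfl : o₁ = o' := row_inj N ho₁L (by omega) (hdown (by rw [← row_succ, hoo]))
        exact (not_inRun_inGap N ho₁ hgap).elim
      · obtain rfl : o₁ = o' := row_inj N ho₁L (by omega) (hdown (by rw [← row_succ, hoo]))
        rwa [eq_of_inRun_inRun N ho₁ hrun]
    · obtain ⟨o', hoo, hgap | ⟨hog, hrun⟩⟩ := inGap_step_down N ho
      · obtain rfl : o₁ = o' := row_inj N ho₁L (by omega) (hdown (by rw [← row_succ, hoo]))
        exact (not_inRun_inGap N ho₁ hgap).elim
      · obtain rfl : o₁ = o' := row_inj N ho₁L (by omega) (hdown (by rw [← row_succ, hoo]))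
        obtain ⟨j, hj, hCj⟩ := hCn
        have hx : N.cross c f i = true := (cross_eq_true_iff N c f i).2
          ⟨fun t ht => hcov t (by unfold Necklace.InGap at ht; omega) (by unfold Necklace.InGap at ht; omega),
            Or.inr (by rw [← hog, ← hoo, Nat.add_sub_cancel]; exact hf), htop⟩
        rw [eq_of_inRun_inRun N ho₁ hrun]
        exact hC₂ hCj (Or.inr (Or.inl ⟨hx, hj⟩))

/-! ## §6 The induction along the black path and the registered stub -/

/-- ONE BLACK EDGE of the wider slab preserves the invariant. -/
theorem good_step (hcol : N.col = fun r => y.1 (Fin.last w, r)) (hC₁ : ∀ j, N.RunMeets y n (3 * n) j → C j)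
    (hC₂ : ∀ {j j' : Fin N.k}, C j → N.Linked y (N.crossVec c f) j j' → C j') {a b : Fin (w + 1 + 1) × ZMod L}
    (hg : (∀ i : Fin (w + 1), a.1 = i.castSucc →
        (∃ r₁ : ZMod L, n ≤ r₁.val ∧ r₁.val < 3 * n ∧ BlackConn y ((0 : Fin (w + 1)), r₁) (i, a.2)) ∨
          ∃ j, C j ∧ ∃ v ∈ N.runCells j, BlackConn y v (i, a.2)) ∧
      (a.1 = Fin.last (w + 1) → ∃ o, o < L ∧ N.row o = a.2 ∧ ((∃ i, N.InRun i o ∧ C i) ∨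
        (∃ i, N.InGap i o ∧ C i ∧ (∀ t, N.gapStart i ≤ t → t ≤ o → c (N.row t) = true) ∧
          (c (N.row (N.gapStart i - 1)) = true ∨ f (N.row (N.gapStart i - 1)) = false)) ∨
        (∃ i, N.InGap i o ∧ (∃ j : Fin N.k, j.val = (i.val + 1) % N.k ∧ C j) ∧
          (∀ t, o ≤ t → t < N.gapStart i + N.gapLen i → c (N.row t) = true) ∧
          (c (N.row (N.gapStart i + N.gapLen i)) = true ∨ f (N.row (N.gapStart i + N.gapLen i - 1)) = true)))))
    (hab : ((splitEquiv w L).symm (y, (c, f))).1 a = true ∧ ((splitEquiv w L).symm (y, (c, f))).1 b = true ∧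
      (cylGraph (w + 1) L ((splitEquiv w L).symm (y, (c, f))).2).Adj a b) :
    (∀ i : Fin (w + 1), b.1 = i.castSucc →
        (∃ r₁ : ZMod L, n ≤ r₁.val ∧ r₁.val < 3 * n ∧ BlackConn y ((0 : Fin (w + 1)), r₁) (i, b.2)) ∨
          ∃ j, C j ∧ ∃ v ∈ N.runCells j, BlackConn y v (i, b.2)) ∧
      (b.1 = Fin.last (w + 1) → ∃ o, o < L ∧ N.row o = b.2 ∧ ((∃ i, N.InRun i o ∧ C i) ∨
        (∃ i, N.InGap i o ∧ C i ∧ (∀ t, N.gapStart i ≤ t → t ≤ o → c (N.row t) = true) ∧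
          (c (N.row (N.gapStart i - 1)) = true ∨ f (N.row (N.gapStart i - 1)) = false)) ∨
        (∃ i, N.InGap i o ∧ (∃ j : Fin N.k, j.val = (i.val + 1) % N.k ∧ C j) ∧
          (∀ t, o ≤ t → t < N.gapStart i + N.gapLen i → c (N.row t) = true) ∧
          (c (N.row (N.gapStart i + N.gapLen i)) = true ∨ f (N.row (N.gapStart i + N.gapLen i - 1)) = true)))) := by
  obtain ⟨a1, ar⟩ := a
  obtain ⟨b1, br⟩ := b
  obtain ⟨ha, hb, hadj⟩ := hab
  rcases Fin.eq_castSucc_or_eq_last a1 with ⟨i, rfl⟩ | rfl <;>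
    rcases Fin.eq_castSucc_or_eq_last b1 with ⟨i', rfl⟩ | rfl
  · -- old → old: an edge of `y`
    rw [ext_fst_castSucc] at hb
    have hadj' := (adj_castSucc_iff (y := y) (c := c) (f := f) (i, ar) (i', br)).1 hadj
    refine ⟨fun i'' h => ?_, fun h => absurd h (Fin.castSucc_ne_last _)⟩
    rw [← Fin.castSucc_inj.1 h]
    exact goodI_step (hg.1 i rfl) hb hadj'
  · -- old → new: entering the new column from a run cell
    obtain ⟨rfl, he⟩ := (adj_castSucc_last_iff i ar br).1 hadj
    rw [ext_fst_castSucc] at ha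
    rw [ext_fst_last] at hb
    obtain ⟨j, o, -, ho, hro⟩ := exists_inRun_of_col N (show N.col ar = true by rw [hcol]; exact ha)
    have hC := mem_of_goodI hC₁ hC₂ (hg.1 _ rfl) ho hro
    exact ⟨fun i'' h => absurd h.symm (Fin.castSucc_ne_last _), fun _ => goodN_of_entry hC ho hro hb he⟩
  · -- new → old: leaving the new column onto a run cell
    obtain ⟨rfl, he⟩ := (adj_castSucc_last_iff i' br ar).1 hadj.symm
    rw [ext_fst_last] at ha
    rw [ext_fst_castSucc] at hb
    obtain ⟨i₁, o₁, -, ho₁, hro₁⟩ := exists_inRun_of_col N (show N.col br = true by rw [hcol]; exact hb)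
    have hC : C i₁ := by
      refine mem_of_exit hC₂ (hg.2 rfl) ho₁ ?_
      rw [hro₁]
      rcases he with h | ⟨h1, h2⟩ | ⟨h1, h2⟩
      exacts [Or.inl h.symm, Or.inr (Or.inr ⟨h1, h2⟩), Or.inr (Or.inl ⟨h1, h2⟩)]
    refine ⟨fun i'' h => ?_, fun h => absurd h (Fin.castSucc_ne_last _)⟩
    rw [← Fin.castSucc_inj.1 h]
    exact Or.inr ⟨i₁, hC, _, hro₁ ▸ mk_mem_runCells N ho₁, blackConn_refl hb⟩
  · -- new → new: a vertical step in the new column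
    obtain ⟨-, he⟩ := (adj_last_last_iff ar br).1 hadj
    rw [ext_fst_last] at ha hb
    exact ⟨fun i'' h => absurd h.symm (Fin.castSucc_ne_last _), fun _ => goodN_step hC₂ (hg.2 rfl) ha hb he⟩

/-- THE INVARIANT along a black path of the wider slab starting on the first arc. -/
theorem good_of_rtg (hcol : N.col = fun r => y.1 (Fin.last w, r)) (hC₁ : ∀ j, N.RunMeets y n (3 * n) j → C j)
    (hC₂ : ∀ {j j' : Fin N.k}, C j → N.Linked y (N.crossVec c f) j j' → C j') {r₁ : ZMod L}
    (h1 : n ≤ r₁.val) (h2 : r₁.val < 3 * n) (hb : y.1 (0, r₁) = true) {v : Fin (w + 1 + 1) × ZMod L}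
    (h : Relation.ReflTransGen (fun a b => ((splitEquiv w L).symm (y, (c, f))).1 a = true ∧
        ((splitEquiv w L).symm (y, (c, f))).1 b = true ∧
        (cylGraph (w + 1) L ((splitEquiv w L).symm (y, (c, f))).2).Adj a b) ((0 : Fin (w + 1 + 1)), r₁) v) :
    (∀ i : Fin (w + 1), v.1 = i.castSucc →
        (∃ r₁ : ZMod L, n ≤ r₁.val ∧ r₁.val < 3 * n ∧ BlackConn y ((0 : Fin (w + 1)), r₁) (i, v.2)) ∨
          ∃ j, C j ∧ ∃ v' ∈ N.runCells j, BlackConn y v' (i, v.2)) ∧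
      (v.1 = Fin.last (w + 1) → ∃ o, o < L ∧ N.row o = v.2 ∧ ((∃ i, N.InRun i o ∧ C i) ∨
        (∃ i, N.InGap i o ∧ C i ∧ (∀ t, N.gapStart i ≤ t → t ≤ o → c (N.row t) = true) ∧
          (c (N.row (N.gapStart i - 1)) = true ∨ f (N.row (N.gapStart i - 1)) = false)) ∨
        (∃ i, N.InGap i o ∧ (∃ j : Fin N.k, j.val = (i.val + 1) % N.k ∧ C j) ∧
          (∀ t, o ≤ t → t < N.gapStart i + N.gapLen i → c (N.row t) = true) ∧
          (c (N.row (N.gapStart i + N.gapLen i)) = true ∨ f (N.row (N.gapStart i + N.gapLen i - 1)) = true)))) := by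
  induction h with
  | refl =>
    refine ⟨fun i hi => ?_, fun h => absurd (congrArg Fin.val h) (by simp)⟩
    have hv := congrArg Fin.val hi
    simp only [Fin.val_zero, Fin.val_castSucc] at hv
    obtain rfl : i = 0 := Fin.ext (by rw [Fin.val_zero]; omega)
    exact Or.inl ⟨r₁, h1, h2, blackConn_refl hb⟩
  | tail _ hbc ih => exact good_step hcol hC₁ hC₂ ih hbc

/-- "⇒": the arcs event of the wider slab forces the link function at the crossing vector (the invariant with `C` =
the runs chained to the first arc, read at the endpoint on the second arc). -/
theorem phi_of_arcs (hcol : N.col = fun r => y.1 (Fin.last w, r))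
    (h : (splitEquiv w L).symm (y, (c, f)) ∈ arcsEvent (w + 1) L n) : N.Phi y n (N.crossVec c f) := by
  obtain ⟨r₁, r₂, h1, h2, h3, h4, hB⟩ := h
  have hb0 : y.1 (0, r₁) = true := by
    rw [← ext_fst_castSucc y c f 0 r₁]
    exact hB.1
  have hg := good_of_rtg
    (C := fun j => ∃ i, N.RunMeets y n (3 * n) i ∧ Relation.ReflTransGen (N.Linked y (N.crossVec c f)) i j)
    hcol (fun j hj => ⟨j, hj, Relation.ReflTransGen.refl⟩) (fun ⟨i, hi, hij⟩ hl => ⟨i, hi, hij.tail hl⟩)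
    h1 h2 hb0 (rtg_of_blackConn hB)
  rcases hg.1 0 rfl with ⟨r₁', h1', h2', hB'⟩ | ⟨j, ⟨i, hi, hij⟩, v, hv, hB'⟩
  · exact Or.inl ⟨r₁', r₂, h1', h2', h3, h4, hB'⟩
  · exact Or.inr ⟨i, j, hi, ⟨r₂, h3, h4, v, hv, blackConn_symm hB'⟩, hij⟩

end LinkArcsIffStub

/-- **Registered stub `stub_linkArcsIff` (H1 of the link decomposition, line `defect-closure-exploration`,
reshape v5b)**: the arcs event of the slab of `w + 1` face columns at `(splitEquiv w L).symm (y, (c, f))` is the value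
of the necklace link function `N.Phi y n` at the gap-crossing vector `N.crossVec c f` of the new column. -/
theorem stub_linkArcsIff : LinkArcsIff := fun _ _ _ _ _ N hcol _ _ =>
  ⟨fun h => LinkArcsIffStub.phi_of_arcs hcol h, fun h => LinkArcsIffStub.arcs_of_phi N hcol h⟩

end Summit.CriticalPhenomena.CardyFormulaZ2.Cruxes.IKMixedBoxCrossing.DefectClosureExploration

end
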